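import Summits.AtomisticToContinuum.Crystallization.Theorems.FrustratedLawDichotomyStrainedPatchHomConvexSegmentW45

/-!
# SIGNED, BOX-CONSTRAINED ξ-ELIMINATION («SignedXiElim»), part A: the energy floor on a shuffle ball of radius `D` from value `V`, slope `G` and a
# curvature-sum floor `λ` OF ANY SIGN — `V − G·D + (min λ 0 / 2)·D²` (cell decomp-a2c, lens-5 g106; crux `AperiodicFrustratedLawGap`,
# stmt-AtomisticToContinuum-27623, `(H∣E-zone)` E-piece NEAR boxes; critic rows 1646 (F5), 1647 (E4), 1652 (L1)(L6))

The ξ-elimination of record (`…HomConvexWell.floor_of_uniformlyConvex_segment` → `…HomConvexSegment.sum_floor_of_curvature` →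
`…HomConvexSegmentW45.hcpShifted_floor_W45` → `…HomXiElimL.hcpEnergy_of_xiElimL2`) COMPLETES THE SQUARE: `f(x₀ + v) ≥ V − G²/(2λ)` for every `v`, which
needs `0 < λ` — the source of the LOEW SIGN GATE («no GO before `λ_full > 0` on the near sample», rows 1646 (F5) / 1652 (L6)).  But the floor is only
ever CONSUMED on a BALL `‖ξ − σ(U)‖ ≤ r` (XIDOM-E, `…HomShearFrames.homFloorHcp_of_piecewiseSheet_boxes`), i.e. for `‖v‖ ≤ D`, and every upstream
input is sign-agnostic: `…HomConvexWell.le_of_uniformlyConvex_segment` (`f(x₀+v) ≥ f x₀ + g′0 + (λ/2)‖v‖²`, ANY `λ`),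
`…HomConvexSegment.slope_growth_of_curvature_sum` (signed `κ`), `…HomCurvLeafL2.curv_floor_of_curvCheckL2` (`lamS : ℤ` of any sign),
`…HomCurvLeaf2.slope_bound_of_slopeCheck2`.  On the ball the tangent parabola `t ↦ −G t + (λ/2)t²`, `0 ≤ t ≤ D`, is bounded below by
`−G·D + (min λ 0/2)·D²` (and by its END-POINT value `−G·D + (λ/2)D²` whenever `λ·D ≤ G`, i.e. the vertex lies beyond the ball), so

  ★★★ `V − G·D + (min λ 0 / 2)·D² ≤ f(x₀ + v)` for `‖v‖ ≤ D` — NO SIGN CONDITION ON `λ`.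

For `λ > 0` this is the floor `V − G·D`, which BEATS `V − G²/(2λ)` iff `2λD < G` (the unconstrained minimiser `G/λ` lies well outside the ball; near zone of
record: `D ≈ 10⁻²`, `G/λ ≈ 10⁻¹`); for `λ ≤ 0` it costs `|λ|D²/2 = |λ|·4.4·10⁻⁵ ≈ 0.027·|λ| m` at the ζ-centred `D = (5/4)·3/400`, `m = 1/625`
(near sample of record LOEW49 §2 at PLAIN `2⁻⁸`: `λ_near ∈ [−0.47, +0.25]` on N01–N11 and `−1.2` on N00, far tail `τ ∈ [1/2, 1)` by FAR-TAIL-47 ⟹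
`|λ_full| ≲ 1.5` (N00 `≲ 2.2`): loss `≲ 0.04 m` (`0.06 m`) against margins `0.3–5 m`).  Hence the SIGN of the certified curvature floor is not
load-bearing for the E-piece; the binding quantity is the slope-times-diameter term `G·D` (part B §6 records the slope budget of the tightest near frame,
`G ≤ (margin − |λ|D²/2)/D ≈ 0.045`).

THIS PART (generic + `W₄₅`, imports `…HomConvexSegmentW45` only):
* §1 pure arithmetic (`parabola_box_le`, `parabola_endpoint_le`) and the generic normed-space floors `boxFloor_of_segment` (any `λ`),
  `endpointFloor_of_segment` (`λ·D ≤ G`), `bestFloor_of_segment_of_pos` (for `0 < λ`: the max of the tree floor and the box floor);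
* §2 label sums sharing a direction (`…HomConvexSegment` §3 inputs): the MASTER PARABOLA INEQUALITY `sum_parabola_of_curvature`
  (`V + Σ_i segG … 0 + (λ/2)‖Δ‖² ≤ Σ_i W‖p_i + Δ‖`, any `λ`), `sum_boxFloor_of_curvature`, `sum_endpointFloor_of_curvature`; `segG_zero_dir`;
* §3 the hcp shifted family: generic `W` (`hcpShifted_parabola_of_curvature`) and the RECORD potential `W₄₅` with regularity / tube / degenerate
  direction discharged exactly as in `hcpShifted_floor_W45`: ★★★ `hcpShifted_parabola_W45` (master, any `λ`, no `G`, no `D`), `hcpShifted_boxFloor_W45`,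
  `hcpShifted_endpointFloor_W45`, `hcpShifted_bestFloor_W45_of_pos`.
Part B (`…HomSignedWell`): the diameter bookkeeping `D` (balls around a track value, ζ-centred reference, coordinate boxes, integer check) and the
kernel-facing consumers `hcpEnergy_of_xiElimL2_signed` (the cube leaves WITHOUT `0 < lamS`), `hcpShifted_ballFloor_W45`, `hcpEnergy_of_ballLeaves_signed`.

Def-free; 0 sorry; standard axioms; no `set_option` / instances / notation / `#eval`.  `--supports stmt-AtomisticToContinuum-27623 --as helper`.
[folklore: one-variable calculus + the tree's segment calculus; formal bookkeeping]
-/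

noncomputable section

namespace Summit.AtomisticToContinuum.Crystallization.Theorems.FrustratedLawDichotomyStrainedPatchHomSignedWell

open scoped BigOperators
open Summit.AtomisticToContinuum.Crystallization.Theorems.ChargedEnergyGapNegative (E3)
open Summit.AtomisticToContinuum.Crystallization.Theorems.FrustratedLawDichotomyStrainedPatchTaylorChord (segR segN segS segG segGd)
open Summit.AtomisticToContinuum.Crystallization.Theorems.FrustratedLawDichotomyStrainedPatchHomConvexWell
  (le_of_uniformlyConvex_segment floor_of_uniformlyConvex_segment)
open Summit.AtomisticToContinuum.Crystallization.Theorems.FrustratedLawDichotomyStrainedPatchHomConvexSegment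
  (slope_growth_of_curvature_sum hasDerivAt_sum_segment hcpShifted_floor_W45 norm_shuffle_segment_le)
open Summit.AtomisticToContinuum.Crystallization.Theorems.FrustratedLawDichotomyStrainedPatchHomSplit (latPt hexFrame hcpShift)
open Summit.AtomisticToContinuum.Crystallization.Theorems.FrustratedLawDichotomyStrainedPatchEnvelopeTaylor (Wrec)
open Summit.AtomisticToContinuum.Crystallization.Theorems.FrustratedLawDichotomyStrainedPatchTaylorLeaves (junctions differentiableAt_Wrec)
open Summit.AtomisticToContinuum.Crystallization.Theorems.FrustratedLawDichotomyStrainedPatchTaylorRegular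
  (continuousOn_deriv_Wrec differentiableAt_deriv_Wrec)
open Summit.AtomisticToContinuum.Crystallization.Theorems.FrustratedLawDichotomyStrainedPatchHomLatticeBoxHcp (norm_shifted_gt)

/-! ## §1. The tangent parabola on a ball: pure arithmetic and the generic normed-space floors -/

/-- ★ **THE PARABOLA ON `[0, D]`, ANY SIGN**: `0 ≤ G`, `0 ≤ t ≤ D` ⟹ `−G·D + (min λ 0/2)·D² ≤ −G·t + (λ/2)·t²`. [one-variable calculus] -/
theorem parabola_box_le {G lam t D : ℝ} (hG : 0 ≤ G) (ht : 0 ≤ t) (htD : t ≤ D) :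
    -(G * D) + min lam 0 / 2 * D ^ 2 ≤ -(G * t) + lam / 2 * t ^ 2 := by
  have h1 : G * t ≤ G * D := mul_le_mul_of_nonneg_left htD hG
  have h2 : min lam 0 / 2 * D ^ 2 ≤ lam / 2 * t ^ 2 := by
    rcases le_total lam 0 with hl | hl
    · rw [min_eq_left hl]
      have hsq : t ^ 2 ≤ D ^ 2 := by nlinarith
      exact mul_le_mul_of_nonpos_left hsq (by linarith)
    · rw [min_eq_right hl]
      have : 0 ≤ lam / 2 * t ^ 2 := by positivity
      linarith
  linarith

/-- ★ **THE PARABOLA ON `[0, D]`, VERTEX BEYOND THE BALL**: `0 ≤ G`, `0 ≤ t ≤ D`, `λ·D ≤ G` ⟹ `−G·D + (λ/2)·D² ≤ −G·t + (λ/2)·t²` (the end point is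
the minimum; automatic for `λ ≤ 0`). [one-variable calculus: `(D − t)(G − (λ/2)(t + D)) ≥ 0`] -/
theorem parabola_endpoint_le {G lam t D : ℝ} (hG : 0 ≤ G) (ht : 0 ≤ t) (htD : t ≤ D) (hlamD : lam * D ≤ G) :
    -(G * D) + lam / 2 * D ^ 2 ≤ -(G * t) + lam / 2 * t ^ 2 := by
  have hfac : -(G * t) + lam / 2 * t ^ 2 - (-(G * D) + lam / 2 * D ^ 2) = (D - t) * (G - lam / 2 * (t + D)) := by ring
  have h1 : 0 ≤ D - t := by linarith
  have h2 : 0 ≤ G - lam / 2 * (t + D) := by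
    rcases le_total 0 lam with hl | hl
    · have : lam / 2 * (t + D) ≤ lam * D := by nlinarith
      linarith
    · have htD' : 0 ≤ t + D := by linarith
      have : lam / 2 * (t + D) ≤ 0 := by nlinarith
      linarith
  nlinarith [mul_nonneg h1 h2]

section Normed

variable {E : Type*} [NormedAddCommGroup E] [NormedSpace ℝ E]

/-- ★★★ **THE BOX FLOOR** (signed ξ-elimination in a normed space).  `g t := f (x₀ + t • v)` differentiable on `[0,1]` with derivative `g′`,
slope growth `g′ t ≥ g′ 0 + λ‖v‖²·t` for SOME REAL `λ` (no sign condition), centre data `V ≤ f x₀`, `|g′ 0| ≤ G‖v‖` with `0 ≤ G`, and the point in the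
ball `‖v‖ ≤ D` ⟹ `V − G·D + (min λ 0/2)·D² ≤ f (x₀ + v)`. [folklore: `le_of_uniformlyConvex_segment` + `parabola_box_le`] -/
theorem boxFloor_of_segment {f : E → ℝ} {x₀ v : E} {g' : ℝ → ℝ} {lam G V D : ℝ} (hV : V ≤ f x₀) (hG₀ : 0 ≤ G)
    (hg : ∀ t ∈ Set.Icc (0 : ℝ) 1, HasDerivAt (fun t : ℝ => f (x₀ + t • v)) (g' t) t)
    (hmono : ∀ t ∈ Set.Icc (0 : ℝ) 1, g' 0 + lam * ‖v‖ ^ 2 * t ≤ g' t) (hG : |g' 0| ≤ G * ‖v‖) (hD : ‖v‖ ≤ D) :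
    V - G * D + min lam 0 / 2 * D ^ 2 ≤ f (x₀ + v) := by
  have h := le_of_uniformlyConvex_segment hg hmono
  have hr : -(G * ‖v‖) ≤ g' 0 := (abs_le.1 hG).1
  have ha := parabola_box_le (lam := lam) hG₀ (norm_nonneg v) hD
  linarith

/-- ★★ **THE END-POINT FLOOR**: as `boxFloor_of_segment` with `λ·D ≤ G` (the parabola's vertex `G/λ` lies beyond the ball, or `λ ≤ 0`) ⟹ the sharper
`V − G·D + (λ/2)·D² ≤ f (x₀ + v)`. [folklore: `le_of_uniformlyConvex_segment` + `parabola_endpoint_le`] -/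
theorem endpointFloor_of_segment {f : E → ℝ} {x₀ v : E} {g' : ℝ → ℝ} {lam G V D : ℝ} (hV : V ≤ f x₀) (hG₀ : 0 ≤ G)
    (hg : ∀ t ∈ Set.Icc (0 : ℝ) 1, HasDerivAt (fun t : ℝ => f (x₀ + t • v)) (g' t) t)
    (hmono : ∀ t ∈ Set.Icc (0 : ℝ) 1, g' 0 + lam * ‖v‖ ^ 2 * t ≤ g' t) (hG : |g' 0| ≤ G * ‖v‖) (hD : ‖v‖ ≤ D) (hlamD : lam * D ≤ G) :
    V - G * D + lam / 2 * D ^ 2 ≤ f (x₀ + v) := by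
  have h := le_of_uniformlyConvex_segment hg hmono
  have hr : -(G * ‖v‖) ≤ g' 0 := (abs_le.1 hG).1
  have ha := parabola_endpoint_le hG₀ (norm_nonneg v) hD hlamD
  linarith

/-- ★ For `0 < λ` BOTH the tree's complete-the-square floor `V − G²/(2λ)` (`…HomConvexWell.floor_of_uniformlyConvex_segment`) and the box floor
`V − G·D` hold; a certificate takes the larger (the box floor wins iff `G·D < G²/(2λ)`, i.e. iff `2λD < G`). [formal bookkeeping] -/
theorem bestFloor_of_segment_of_pos {f : E → ℝ} {x₀ v : E} {g' : ℝ → ℝ} {lam G V D : ℝ} (hlam : 0 < lam) (hV : V ≤ f x₀) (hG₀ : 0 ≤ G)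
    (hg : ∀ t ∈ Set.Icc (0 : ℝ) 1, HasDerivAt (fun t : ℝ => f (x₀ + t • v)) (g' t) t)
    (hmono : ∀ t ∈ Set.Icc (0 : ℝ) 1, g' 0 + lam * ‖v‖ ^ 2 * t ≤ g' t) (hG : |g' 0| ≤ G * ‖v‖) (hD : ‖v‖ ≤ D) :
    max (V - G ^ 2 / (2 * lam)) (V - G * D) ≤ f (x₀ + v) := by
  refine max_le (floor_of_uniformlyConvex_segment hlam hV hg hmono hG) ?_
  have h := boxFloor_of_segment (lam := lam) hV hG₀ hg hmono hG hD
  rw [min_eq_right hlam.le] at h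
  linarith

end Normed

/-! ## §2. Label sums sharing a direction: the master parabola inequality and the two floors -/

/-- The slope term vanishes in the degenerate direction: `segG W₁ p 0 s = 0`. [definitional] -/
theorem segG_zero_dir (W₁ : ℝ → ℝ) (p : EuclideanSpace ℝ (Fin 3)) (s : ℝ) : segG W₁ p 0 s = 0 := by
  simp [segG, segS, segN]

/-- ★★ **MASTER PARABOLA INEQUALITY FOR A LABEL SUM** (the hypotheses of `…HomConvexSegment.slope_growth_of_curvature_sum` with `κ = λ‖Δ‖²`, ANY real
`λ`, and a value bound `V ≤ Σ_i W‖p_i‖`): `V + Σ_i segG W₁ (p i) Δ 0 + (λ/2)‖Δ‖² ≤ Σ_i W‖p_i + Δ‖`. [folklore chaining: `le_of_uniformlyConvex_segment`] -/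
theorem sum_parabola_of_curvature {ι : Type*} (S : Finset ι) (p : ι → EuclideanSpace ℝ (Fin 3)) {Δ : EuclideanSpace ℝ (Fin 3)} (hΔ : Δ ≠ 0)
    {W W₁ : ℝ → ℝ} (J : Finset ℝ) {a b lam V : ℝ} (ha : 0 < a)
    (hW : ∀ r, a ≤ r → r ≤ b → HasDerivAt W (W₁ r) r) (hcont : ContinuousOn W₁ (Set.Icc a b))
    (hdiff : ∀ r, a < r → r < b → r ∉ J → HasDerivAt W₁ (deriv W₁ r) r)
    (htube : ∀ i ∈ S, ∀ s ∈ Set.Icc (0 : ℝ) 1, a ≤ ‖p i + s • Δ‖ ∧ ‖p i + s • Δ‖ ≤ b)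
    (hcurv : ∀ s ∈ Set.Ioo (0 : ℝ) 1, (∀ i ∈ S, a < segR (p i) Δ s ∧ segR (p i) Δ s < b ∧ segR (p i) Δ s ∉ J) →
      lam * ‖Δ‖ ^ 2 ≤ ∑ i ∈ S, segGd W₁ (p i) Δ s)
    (hV : V ≤ ∑ i ∈ S, W ‖p i‖) :
    V + ∑ i ∈ S, segG W₁ (p i) Δ 0 + lam / 2 * ‖Δ‖ ^ 2 ≤ ∑ i ∈ S, W ‖p i + Δ‖ := by
  have hmono := slope_growth_of_curvature_sum S p hΔ J ha hcont hdiff htube hcurv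
  have key := le_of_uniformlyConvex_segment (f := fun x : EuclideanSpace ℝ (Fin 3) => ∑ i ∈ S, W ‖p i + x‖) (x₀ := 0) (v := Δ)
    (g' := fun s => ∑ i ∈ S, segG W₁ (p i) Δ s) (lam := lam)
    (fun s hs => by simpa using hasDerivAt_sum_segment S p Δ ha hW htube hs)
    (fun s hs => by have := hmono s hs; linarith)
  have key' : ∑ i ∈ S, W ‖p i‖ + ∑ i ∈ S, segG W₁ (p i) Δ 0 + lam / 2 * ‖Δ‖ ^ 2 ≤ ∑ i ∈ S, W ‖p i + Δ‖ := by
    simpa using key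
  linarith

/-- ★★★ **BOX FLOOR OF A LABEL SUM** (signed analogue of `…HomConvexSegment.sum_floor_of_curvature`): the master inequality plus `0 ≤ G`,
`|Σ_i segG W₁ (p i) Δ 0| ≤ G‖Δ‖`, `‖Δ‖ ≤ D` ⟹ `V − G·D + (min λ 0/2)·D² ≤ Σ_i W‖p_i + Δ‖` — NO `0 < λ`. [folklore chaining] -/
theorem sum_boxFloor_of_curvature {ι : Type*} (S : Finset ι) (p : ι → EuclideanSpace ℝ (Fin 3)) {Δ : EuclideanSpace ℝ (Fin 3)} (hΔ : Δ ≠ 0)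
    {W W₁ : ℝ → ℝ} (J : Finset ℝ) {a b lam G V D : ℝ} (ha : 0 < a) (hG₀ : 0 ≤ G)
    (hW : ∀ r, a ≤ r → r ≤ b → HasDerivAt W (W₁ r) r) (hcont : ContinuousOn W₁ (Set.Icc a b))
    (hdiff : ∀ r, a < r → r < b → r ∉ J → HasDerivAt W₁ (deriv W₁ r) r)
    (htube : ∀ i ∈ S, ∀ s ∈ Set.Icc (0 : ℝ) 1, a ≤ ‖p i + s • Δ‖ ∧ ‖p i + s • Δ‖ ≤ b)
    (hcurv : ∀ s ∈ Set.Ioo (0 : ℝ) 1, (∀ i ∈ S, a < segR (p i) Δ s ∧ segR (p i) Δ s < b ∧ segR (p i) Δ s ∉ J) →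
      lam * ‖Δ‖ ^ 2 ≤ ∑ i ∈ S, segGd W₁ (p i) Δ s)
    (hV : V ≤ ∑ i ∈ S, W ‖p i‖) (hG : |∑ i ∈ S, segG W₁ (p i) Δ 0| ≤ G * ‖Δ‖) (hD : ‖Δ‖ ≤ D) :
    V - G * D + min lam 0 / 2 * D ^ 2 ≤ ∑ i ∈ S, W ‖p i + Δ‖ := by
  have key := sum_parabola_of_curvature S p hΔ J ha hW hcont hdiff htube hcurv hV
  have hr : -(G * ‖Δ‖) ≤ ∑ i ∈ S, segG W₁ (p i) Δ 0 := (abs_le.1 hG).1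
  have har := parabola_box_le (lam := lam) hG₀ (norm_nonneg Δ) hD
  linarith

/-- ★★ **END-POINT FLOOR OF A LABEL SUM**: as `sum_boxFloor_of_curvature` with `λ·D ≤ G` ⟹ `V − G·D + (λ/2)·D² ≤ Σ_i W‖p_i + Δ‖`. [folklore chaining] -/
theorem sum_endpointFloor_of_curvature {ι : Type*} (S : Finset ι) (p : ι → EuclideanSpace ℝ (Fin 3)) {Δ : EuclideanSpace ℝ (Fin 3)} (hΔ : Δ ≠ 0)
    {W W₁ : ℝ → ℝ} (J : Finset ℝ) {a b lam G V D : ℝ} (ha : 0 < a) (hG₀ : 0 ≤ G)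
    (hW : ∀ r, a ≤ r → r ≤ b → HasDerivAt W (W₁ r) r) (hcont : ContinuousOn W₁ (Set.Icc a b))
    (hdiff : ∀ r, a < r → r < b → r ∉ J → HasDerivAt W₁ (deriv W₁ r) r)
    (htube : ∀ i ∈ S, ∀ s ∈ Set.Icc (0 : ℝ) 1, a ≤ ‖p i + s • Δ‖ ∧ ‖p i + s • Δ‖ ≤ b)
    (hcurv : ∀ s ∈ Set.Ioo (0 : ℝ) 1, (∀ i ∈ S, a < segR (p i) Δ s ∧ segR (p i) Δ s < b ∧ segR (p i) Δ s ∉ J) →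
      lam * ‖Δ‖ ^ 2 ≤ ∑ i ∈ S, segGd W₁ (p i) Δ s)
    (hV : V ≤ ∑ i ∈ S, W ‖p i‖) (hG : |∑ i ∈ S, segG W₁ (p i) Δ 0| ≤ G * ‖Δ‖) (hD : ‖Δ‖ ≤ D) (hlamD : lam * D ≤ G) :
    V - G * D + lam / 2 * D ^ 2 ≤ ∑ i ∈ S, W ‖p i + Δ‖ := by
  have key := sum_parabola_of_curvature S p hΔ J ha hW hcont hdiff htube hcurv hV
  have hr : -(G * ‖Δ‖) ≤ ∑ i ∈ S, segG W₁ (p i) Δ 0 := (abs_le.1 hG).1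
  have har := parabola_endpoint_le hG₀ (norm_nonneg Δ) hD hlamD
  linarith

/-! ## §3. The hcp shifted-family sum: generic `W`, then the record potential `W₄₅` with regularity discharged -/

/-- ★★ **MASTER PARABOLA INEQUALITY FOR THE hcp SHIFTED-FAMILY SUM** (generic pair potential; `p_b = latPt U hexFrame b + U(hcpShift + ξ₀)`,
`Δ = U(ξ − ξ₀) ≠ 0`): `V + Σ_b segG W₁ p_b Δ 0 + (λ/2)‖Δ‖² ≤ Σ_b W‖latPt U hexFrame b + U(hcpShift + ξ)‖`, any real `λ`.
[folklore chaining: `sum_parabola_of_curvature` + linearity of `U`, cf. `…HomConvexSegment.hcpShifted_floor_of_curvature`] -/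
theorem hcpShifted_parabola_of_curvature (B : Finset (Fin 3 → ℤ)) (U : E3 →L[ℝ] E3) (ξ₀ ξ : E3) (hξ : U (ξ - ξ₀) ≠ 0)
    {W W₁ : ℝ → ℝ} (J : Finset ℝ) {a b lam V : ℝ} (ha : 0 < a)
    (hW : ∀ r, a ≤ r → r ≤ b → HasDerivAt W (W₁ r) r) (hcont : ContinuousOn W₁ (Set.Icc a b))
    (hdiff : ∀ r, a < r → r < b → r ∉ J → HasDerivAt W₁ (deriv W₁ r) r)
    (htube : ∀ bb ∈ B, ∀ s ∈ Set.Icc (0 : ℝ) 1,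
      a ≤ ‖latPt U hexFrame bb + U (hcpShift + ξ₀) + s • U (ξ - ξ₀)‖ ∧ ‖latPt U hexFrame bb + U (hcpShift + ξ₀) + s • U (ξ - ξ₀)‖ ≤ b)
    (hcurv : ∀ s ∈ Set.Ioo (0 : ℝ) 1,
      (∀ bb ∈ B, a < segR (latPt U hexFrame bb + U (hcpShift + ξ₀)) (U (ξ - ξ₀)) s ∧
        segR (latPt U hexFrame bb + U (hcpShift + ξ₀)) (U (ξ - ξ₀)) s < b ∧ segR (latPt U hexFrame bb + U (hcpShift + ξ₀)) (U (ξ - ξ₀)) s ∉ J) →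
      lam * ‖U (ξ - ξ₀)‖ ^ 2 ≤ ∑ bb ∈ B, segGd W₁ (latPt U hexFrame bb + U (hcpShift + ξ₀)) (U (ξ - ξ₀)) s)
    (hV : V ≤ ∑ bb ∈ B, W ‖latPt U hexFrame bb + U (hcpShift + ξ₀)‖) :
    V + ∑ bb ∈ B, segG W₁ (latPt U hexFrame bb + U (hcpShift + ξ₀)) (U (ξ - ξ₀)) 0 + lam / 2 * ‖U (ξ - ξ₀)‖ ^ 2 ≤
      ∑ bb ∈ B, W ‖latPt U hexFrame bb + U (hcpShift + ξ)‖ := by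
  have key := sum_parabola_of_curvature B (fun bb => latPt U hexFrame bb + U (hcpShift + ξ₀)) hξ J ha hW hcont hdiff htube hcurv hV
  have hpt : ∀ bb : Fin 3 → ℤ, latPt U hexFrame bb + U (hcpShift + ξ₀) + U (ξ - ξ₀) = latPt U hexFrame bb + U (hcpShift + ξ) := by
    intro bb
    rw [add_assoc, ← map_add]
    congr 2
    abel
  simpa only [hpt] using key

/-- ★★★ **MASTER PARABOLA INEQUALITY FOR THE hcp SHIFTED-FAMILY SUM OF `W₄₅`** (regularity, tube and degenerate direction discharged as in
`…HomConvexSegmentW45.hcpShifted_floor_W45`).  For `‖U − 1‖ ≤ 1/4`, `‖ξ₀‖, ‖ξ‖ ≤ 1/4`, any label finset `B`, ANY REAL `λ` with the curvature-sum floor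
`λ‖Δ‖² ≤ Σ_b segGd W₄₅′ p_b Δ s` at the junction-free parameters (`Δ = U(ξ − ξ₀)`), and a value bound `V ≤ Σ_b W₄₅‖p_b‖`:
`V + Σ_b segG W₄₅′ p_b Δ 0 + (λ/2)‖Δ‖² ≤ Σ_b W₄₅‖latPt U hexFrame b + U(hcpShift + ξ)‖`. [folklore chaining] -/
theorem hcpShifted_parabola_W45 (B : Finset (Fin 3 → ℤ)) {U : E3 →L[ℝ] E3} (hU : ‖U - 1‖ ≤ 1 / 4) {ξ₀ ξ : E3} (hξ₀ : ‖ξ₀‖ ≤ 1 / 4)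
    (hξ : ‖ξ‖ ≤ 1 / 4) {lam V : ℝ}
    (hcurv : ∀ s ∈ Set.Ioo (0 : ℝ) 1,
      (∀ bb ∈ B, segR (latPt U hexFrame bb + U (hcpShift + ξ₀)) (U (ξ - ξ₀)) s ∉ junctions) →
      lam * ‖U (ξ - ξ₀)‖ ^ 2 ≤ ∑ bb ∈ B, segGd (deriv Wrec) (latPt U hexFrame bb + U (hcpShift + ξ₀)) (U (ξ - ξ₀)) s)
    (hV : V ≤ ∑ bb ∈ B, Wrec ‖latPt U hexFrame bb + U (hcpShift + ξ₀)‖) :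
    V + ∑ bb ∈ B, segG (deriv Wrec) (latPt U hexFrame bb + U (hcpShift + ξ₀)) (U (ξ - ξ₀)) 0 + lam / 2 * ‖U (ξ - ξ₀)‖ ^ 2 ≤
      ∑ bb ∈ B, Wrec ‖latPt U hexFrame bb + U (hcpShift + ξ)‖ := by
  by_cases hΔ : U (ξ - ξ₀) = 0
  · -- degenerate direction: `ξ` and `ξ₀` give the same points, the slope and curvature terms vanish
    have hUeq : U (hcpShift + ξ) = U (hcpShift + ξ₀) := by
      have : hcpShift + ξ = (hcpShift + ξ₀) + (ξ - ξ₀) := by abel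
      rw [this, map_add, hΔ, add_zero]
    have h0 : ∑ bb ∈ B, segG (deriv Wrec) (latPt U hexFrame bb + U (hcpShift + ξ₀)) (U (ξ - ξ₀)) 0 = 0 := by
      rw [hΔ]; exact Finset.sum_eq_zero fun bb _ => segG_zero_dir _ _ _
    rw [h0, hΔ, hUeq, norm_zero]
    have : lam / 2 * (0 : ℝ) ^ 2 = 0 := by ring
    linarith
  -- the tube: floor 3/8 from the lattice geometry, ceiling from finiteness (verbatim `hcpShifted_floor_W45`)
  set p : (Fin 3 → ℤ) → E3 := fun bb => latPt U hexFrame bb + U (hcpShift + ξ₀) with hp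
  set Δ : E3 := U (ξ - ξ₀) with hΔdef
  set bhi : ℝ := (∑ bb ∈ B, ‖p bb‖) + ‖Δ‖ + 1 with hbhi
  have hseg : ∀ bb : Fin 3 → ℤ, ∀ s : ℝ, p bb + s • Δ = latPt U hexFrame bb + U (hcpShift + (ξ₀ + s • (ξ - ξ₀))) := by
    intro bb s
    simp only [hp, hΔdef, map_add, map_smul]
    abel
  have htube : ∀ bb ∈ B, ∀ s ∈ Set.Icc (0 : ℝ) 1, 3 / 8 ≤ ‖p bb + s • Δ‖ ∧ ‖p bb + s • Δ‖ ≤ bhi := by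
    intro bb hbb s hs
    constructor
    · rw [hseg]
      exact (norm_shifted_gt hU (norm_shuffle_segment_le hξ₀ hξ hs) bb).le
    · have h1 : ‖p bb + s • Δ‖ ≤ ‖p bb‖ + ‖Δ‖ := by
        calc ‖p bb + s • Δ‖ ≤ ‖p bb‖ + ‖s • Δ‖ := norm_add_le _ _
          _ ≤ ‖p bb‖ + ‖Δ‖ := by
              rw [norm_smul, Real.norm_eq_abs, abs_of_nonneg hs.1]
              nlinarith [norm_nonneg Δ, hs.2]
      have h2 : ‖p bb‖ ≤ ∑ bb ∈ B, ‖p bb‖ := Finset.single_le_sum (fun _ _ => norm_nonneg _) hbb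
      rw [hbhi]; linarith
  have ha : (0 : ℝ) < 3 / 8 := by norm_num
  have hW : ∀ r, (3 : ℝ) / 8 ≤ r → r ≤ bhi → HasDerivAt Wrec (deriv Wrec r) r := fun r hr _ =>
    (differentiableAt_Wrec (ha.trans_le hr).ne').hasDerivAt
  have hcont : ContinuousOn (deriv Wrec) (Set.Icc (3 / 8) bhi) := continuousOn_deriv_Wrec.mono fun r hr => ha.trans_le hr.1
  have hdiff : ∀ r, (3 : ℝ) / 8 < r → r < bhi → r ∉ junctions → HasDerivAt (deriv Wrec) (deriv (deriv Wrec) r) r :=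
    fun r hr _ hJ => (differentiableAt_deriv_Wrec (ha.trans hr) hJ).hasDerivAt
  have hcurv' : ∀ s ∈ Set.Ioo (0 : ℝ) 1, (∀ bb ∈ B, 3 / 8 < segR (p bb) Δ s ∧ segR (p bb) Δ s < bhi ∧ segR (p bb) Δ s ∉ junctions) →
      lam * ‖Δ‖ ^ 2 ≤ ∑ bb ∈ B, segGd (deriv Wrec) (p bb) Δ s :=
    fun s hs hgood => hcurv s hs fun bb hbb => (hgood bb hbb).2.2
  exact hcpShifted_parabola_of_curvature B U ξ₀ ξ hΔ junctions ha hW hcont hdiff htube hcurv' hV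

/-- ★★★ **BOX FLOOR FOR THE hcp SHIFTED-FAMILY SUM OF `W₄₅`** — the hypotheses of `hcpShifted_floor_W45` WITHOUT `0 < λ`, plus `0 ≤ G` and the ball
`‖U(ξ − ξ₀)‖ ≤ D`: `V − G·D + (min λ 0/2)·D² ≤ Σ_b W₄₅‖latPt U hexFrame b + U(hcpShift + ξ)‖`. [folklore chaining] -/
theorem hcpShifted_boxFloor_W45 (B : Finset (Fin 3 → ℤ)) {U : E3 →L[ℝ] E3} (hU : ‖U - 1‖ ≤ 1 / 4) {ξ₀ ξ : E3} (hξ₀ : ‖ξ₀‖ ≤ 1 / 4)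
    (hξ : ‖ξ‖ ≤ 1 / 4) {lam G V D : ℝ} (hG₀ : 0 ≤ G)
    (hcurv : ∀ s ∈ Set.Ioo (0 : ℝ) 1,
      (∀ bb ∈ B, segR (latPt U hexFrame bb + U (hcpShift + ξ₀)) (U (ξ - ξ₀)) s ∉ junctions) →
      lam * ‖U (ξ - ξ₀)‖ ^ 2 ≤ ∑ bb ∈ B, segGd (deriv Wrec) (latPt U hexFrame bb + U (hcpShift + ξ₀)) (U (ξ - ξ₀)) s)
    (hV : V ≤ ∑ bb ∈ B, Wrec ‖latPt U hexFrame bb + U (hcpShift + ξ₀)‖)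
    (hG : |∑ bb ∈ B, segG (deriv Wrec) (latPt U hexFrame bb + U (hcpShift + ξ₀)) (U (ξ - ξ₀)) 0| ≤ G * ‖U (ξ - ξ₀)‖)
    (hD : ‖U (ξ - ξ₀)‖ ≤ D) :
    V - G * D + min lam 0 / 2 * D ^ 2 ≤ ∑ bb ∈ B, Wrec ‖latPt U hexFrame bb + U (hcpShift + ξ)‖ := by
  have key := hcpShifted_parabola_W45 B hU hξ₀ hξ hcurv hV
  have hr : -(G * ‖U (ξ - ξ₀)‖) ≤ ∑ bb ∈ B, segG (deriv Wrec) (latPt U hexFrame bb + U (hcpShift + ξ₀)) (U (ξ - ξ₀)) 0 := (abs_le.1 hG).1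
  have har := parabola_box_le (lam := lam) hG₀ (norm_nonneg (U (ξ - ξ₀))) hD
  linarith

/-- ★★ **END-POINT FLOOR FOR THE hcp SHIFTED-FAMILY SUM OF `W₄₅`**: as `hcpShifted_boxFloor_W45` with `λ·D ≤ G` ⟹
`V − G·D + (λ/2)·D² ≤ Σ_b W₄₅‖latPt U hexFrame b + U(hcpShift + ξ)‖`. [folklore chaining] -/
theorem hcpShifted_endpointFloor_W45 (B : Finset (Fin 3 → ℤ)) {U : E3 →L[ℝ] E3} (hU : ‖U - 1‖ ≤ 1 / 4) {ξ₀ ξ : E3} (hξ₀ : ‖ξ₀‖ ≤ 1 / 4)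
    (hξ : ‖ξ‖ ≤ 1 / 4) {lam G V D : ℝ} (hG₀ : 0 ≤ G)
    (hcurv : ∀ s ∈ Set.Ioo (0 : ℝ) 1,
      (∀ bb ∈ B, segR (latPt U hexFrame bb + U (hcpShift + ξ₀)) (U (ξ - ξ₀)) s ∉ junctions) →
      lam * ‖U (ξ - ξ₀)‖ ^ 2 ≤ ∑ bb ∈ B, segGd (deriv Wrec) (latPt U hexFrame bb + U (hcpShift + ξ₀)) (U (ξ - ξ₀)) s)
    (hV : V ≤ ∑ bb ∈ B, Wrec ‖latPt U hexFrame bb + U (hcpShift + ξ₀)‖)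
    (hG : |∑ bb ∈ B, segG (deriv Wrec) (latPt U hexFrame bb + U (hcpShift + ξ₀)) (U (ξ - ξ₀)) 0| ≤ G * ‖U (ξ - ξ₀)‖)
    (hD : ‖U (ξ - ξ₀)‖ ≤ D) (hlamD : lam * D ≤ G) :
    V - G * D + lam / 2 * D ^ 2 ≤ ∑ bb ∈ B, Wrec ‖latPt U hexFrame bb + U (hcpShift + ξ)‖ := by
  have key := hcpShifted_parabola_W45 B hU hξ₀ hξ hcurv hV
  have hr : -(G * ‖U (ξ - ξ₀)‖) ≤ ∑ bb ∈ B, segG (deriv Wrec) (latPt U hexFrame bb + U (hcpShift + ξ₀)) (U (ξ - ξ₀)) 0 := (abs_le.1 hG).1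
  have har := parabola_endpoint_le hG₀ (norm_nonneg (U (ξ - ξ₀))) hD hlamD
  linarith

/-- ★ For `0 < λ` the tree floor `hcpShifted_floor_W45` and the box floor both hold: their max is certified. [formal bookkeeping] -/
theorem hcpShifted_bestFloor_W45_of_pos (B : Finset (Fin 3 → ℤ)) {U : E3 →L[ℝ] E3} (hU : ‖U - 1‖ ≤ 1 / 4) {ξ₀ ξ : E3} (hξ₀ : ‖ξ₀‖ ≤ 1 / 4)
    (hξ : ‖ξ‖ ≤ 1 / 4) {lam G V D : ℝ} (hlam : 0 < lam) (hG₀ : 0 ≤ G)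
    (hcurv : ∀ s ∈ Set.Ioo (0 : ℝ) 1,
      (∀ bb ∈ B, segR (latPt U hexFrame bb + U (hcpShift + ξ₀)) (U (ξ - ξ₀)) s ∉ junctions) →
      lam * ‖U (ξ - ξ₀)‖ ^ 2 ≤ ∑ bb ∈ B, segGd (deriv Wrec) (latPt U hexFrame bb + U (hcpShift + ξ₀)) (U (ξ - ξ₀)) s)
    (hV : V ≤ ∑ bb ∈ B, Wrec ‖latPt U hexFrame bb + U (hcpShift + ξ₀)‖)
    (hG : |∑ bb ∈ B, segG (deriv Wrec) (latPt U hexFrame bb + U (hcpShift + ξ₀)) (U (ξ - ξ₀)) 0| ≤ G * ‖U (ξ - ξ₀)‖)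
    (hD : ‖U (ξ - ξ₀)‖ ≤ D) :
    max (V - G ^ 2 / (2 * lam)) (V - G * D) ≤ ∑ bb ∈ B, Wrec ‖latPt U hexFrame bb + U (hcpShift + ξ)‖ := by
  refine max_le (hcpShifted_floor_W45 B hU hξ₀ hξ hlam hcurv hV hG) ?_
  have h := hcpShifted_boxFloor_W45 B hU hξ₀ hξ hG₀ hcurv hV hG hD
  rw [min_eq_right hlam.le] at h
  linarith

end Summit.AtomisticToContinuum.Crystallization.Theorems.FrustratedLawDichotomyStrainedPatchHomSignedWell

end
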